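import Mathlib.Geometry.Manifold.Instances.Real
import Mathlib.Analysis.InnerProductSpace.PiL2
import Mathlib.Analysis.SpecialFunctions.Pow.Asymptotics
import Literature.Geometry.Lorentzian.Stationary
import Literature.Geometry.Lorentzian.KerrData
import Literature.Geometry.Lorentzian.TrappedSurface
import Literature.Geometry.Lorentzian.WeightedNorms
import Literature.Geometry.Lorentzian.Isometry
import Literature.Geometry.Lorentzian.LeviCivita
import Literature.Geometry.Lorentzian.Einstein
import Literature.Geometry.Lorentzian.Causality
import HarnessLib

-- provenance: harness21/H21/H21/Statements/GR/BlackHoles.lean @ 01f06d7 (interim HEAD d8f2665); M5 mechanical rewrite;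
-- D-0014 named-fact conversion (Literature is proof-complete: unproved published results are `def … : Prop`).
/-!
# Black holes: uniqueness, trapped-surface formation, linear waves on Kerr
(family `gr`, statements **gr.S23**, **gr.S19**, **gr.S24**; trunk G08 = T-LORENTZ, outline
`H21/Outlines/Lorentz.md` §3 ST5, item `GRBlackHoles`; namespace `Literature.GR`)

This Literature file records three groups of known theorems about black holes, on top of the
Lorentz prelude (`Stationary`, `KerrSchild`/`KerrData`, `TrappedSurface`, `WeightedNorms`,
`Isometry`, `LeviCivita`, `Einstein`, `Causality`). Following D-0014, results proved in print but
not in Lean are vendored as **named facts** `def <name> : Prop := <statement>` carrying a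
`[cite: …]` tag; results whose printed hypotheses cannot (yet) be transcribed faithfully are
recorded as **statement schemas** over a hypothesis predicate and assert nothing.

* **gr.S23** `stationary_black_hole_uniqueness` — the "no-hair" theorem in the modern form of
  Chruściel–Costa (arXiv:0806.0016 = Astérisque 321 (2008), Thm. 1.3): a stationary,
  asymptotically flat, `I⁺`-regular, vacuum, analytic four-dimensional space-time whose future
  event horizon is connected and mean non-degenerate has domain of outer communications isometric
  to that of a Kerr space-time. Recorded as a **schema** in the `I⁺`-regularity hypothesis (see
  Design choices); the companion `AlexakisIonescuKlainermanRigidity` (Alexakis–Ionescu–Klainerman,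
  arXiv:0904.0982 = CMP 299 (2010), Main Theorem: analyticity replaced by closeness to Kerr) is
  likewise a schema in its hypotheses **GR**, **SBS**, **PK**.
* **gr.S19** `christodoulou_trapped_surface_formation` — Christodoulou's theorem on the dynamical
  formation of closed trapped surfaces in vacuum (arXiv:0805.3880 = EMS Monographs 2009,
  Thm. 17.1), vendored as the existence consequence it implies (named fact).
* **gr.S24** `drsr_wave_boundedness_kerr`, `drsr_wave_polynomial_decay_kerr`,
  `drsr_wave_local_energy_decay_kerr` — Dafermos–Rodnianski–Shlapentokh-Rothman, arXiv:1402.7034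
  = Ann. of Math. 183 (2016): uniform energy boundedness through the Kerr–Schild leaves (a
  *corollary* of Thm. 3.1, estimate (23), in its §3.3 form for admissible hypersurfaces — see
  *Caveat (foliations)* below; *derived* from that printed theorem alone in
  `Literature.Geometry.Lorentzian.KerrWaveEnergyProofs`, `drsr_wave_boundedness_kerr_of_DRSR`)
  and decay of the energy flux (Cor. 3.1, first energy-flux estimate, rate `τ⁻²`) for `□_g ψ = 0`
  on the full subextremal Kerr exterior `|a| < M` (named facts; the qualitative local-energy-decay
  statement is moreover *derived* from the polynomial one,
  `drsr_wave_local_energy_decay_kerr_of_polynomial_decay`).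

**Not stated (gr.S27).** Boundedness and decay for the Teukolsky equation on Kerr
(Dafermos–Holzegel–Rodnianski, Acta Math. 222 (2019); Shlapentokh-Rothman–Teixeira da Costa,
arXiv:2007.07211, arXiv:2302.08916) is not stated in v0: it needs the spin-weighted Teukolsky
operator in a principal null frame, which the prelude does not provide (outline §4.10).

## Design choices

* **gr.S23 is a schema, not a named fact.** Chruściel–Costa's standing hypothesis
  "`I⁺`-regular" (arXiv:0806.0016, Def. 1.1) requires: the stationary Killing field complete;
  `⟨⟨M_ext⟩⟩` globally hyperbolic; and a spacelike, connected, *acausal hypersurface*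
  `S ⊇ Σ_ext` in `⟨⟨M_ext⟩⟩` whose closure `S̄` is a topological manifold with boundary, the union
  of a compact set and finitely many asymptotic ends, with `∂S̄ := S̄ ∖ S ⊆ 𝓔⁺` *meeting every
  generator of `𝓔⁺` precisely once* (their (1.1); p. 2: "we have not been able to develop a
  coherent theory without assuming some version of (1.1)"; the (1.1)-free statement is their open
  Conjecture 1.2). The v0 prelude has no notion of generator of the (a priori only Lipschitz)
  achronal boundary `𝓔⁺`, nor of "closure a topological manifold with boundary", so Def. 1.1
  cannot be transcribed hypothesis-for-hypothesis; and a named fact stated under any strictly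
  weaker regularity predicate would assert *more* than Thm. 1.3 prints (a `def X : Prop` consumed
  as `(h : X)` is strengthened, not weakened, by dropping hypotheses). Hence, exactly as for the
  Alexakis–Ionescu–Klainerman companion, `I⁺`-regularity enters as a **predicate parameter**
  `IsIPlusRegular : StationaryAFBlackHole → Prop`, and `stationary_black_hole_uniqueness
  IsIPlusRegular` is the *statement* "every `IsIPlusRegular`, analytic, vacuum stationary AF black
  hole with connected non-degenerate horizon has d.o.c. isometric to a subextremal Kerr exterior".
  Chruściel–Costa's Thm. 1.3 is this schema at the transcription of Def. 1.1; that instance is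
  documented, not asserted, and no `[cite]` tag is attached to the schema (its instance at
  `fun _ ↦ True` is an open problem). The interim partial predicate `IsIPlusRegular` of earlier
  versions of this file (global hyperbolicity of the d.o.c. plus a connected achronal *set* ending
  on `𝓔⁺`) is withdrawn: it encoded neither acausality, nor the hypersurface structure, nor (1.1).
  The remaining S23 hypotheses are prelude notions: analyticity (`StationaryAFBlackHole.IsAnalytic`,
  stronger than printed), vacuum (`PseudoRiemannianMetric.IsRicciFlat`), `IsConnected 𝓑.horizon`,
  and `Spacetime.IsNonDegenerateHorizon` (a horizon Killing field tangent to `𝓔⁺` with surface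
  gravity `κ ≠ 0`). The common **conclusion** of the uniqueness theorems is the
  predicate `StationaryAFBlackHole.IsIsometricToKerrExterior`: an isometry
  (`PseudoRiemannianMetric.IsIsometry`, a `Diffeomorph` pulling back the metric) between the open
  submanifold `𝓑.docOpens hF hP` (with the restricted metric, hypothesis `hres`) and the ingoing
  Kerr–Schild exterior chart `Kerr.exterior M a = {r > r₊}` with the `C^∞` Kerr metric
  `Kerr.smoothMetric M a r₊`, for some subextremal `(M, a)`.
* **AIK rigidity, schema form.** Alexakis–Ionescu–Klainerman (arXiv:0904.0982, §1.1) assume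
  **GR** (global regularity: an end diffeomorphic to `ℝ × E_{R₀}` with `T = ∂₀` and Kerr-like
  fall-off, `𝓔 = I⁻(M^{end}) ∩ I⁺(M^{end})` globally hyperbolic, `T` non-vanishing with complete
  orbits meeting `Σ⁰`), **SBS** (smooth bifurcation sphere: `δI^∓(M^{end})` smooth null
  non-expanding hypersurfaces near `S₀`, intersecting transversally) and **PK** (the Mars–Simon
  tensor `𝓢` of `(g, T)`, weighted by `(1 − σ)`, is `ε̄`-small on `Σ⁰ ∩ 𝓔̄`). None of these is a
  prelude notion (no bifurcate horizons, no Ernst potential / Mars–Simon tensor), so all three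
  enter as one predicate parameter `IsRegularCloseToKerr`; the Main Theorem is the schema at
  `GR ∧ SBS ∧ PK`, documented, not asserted. `AlexakisIonescuKlainermanRigidity.apply` and
  `stationary_black_hole_uniqueness.apply` are the tautological hypothesis forms.
* **gr.S19.** Christodoulou's theorem is a large-data theorem for the characteristic initial value
  problem with "short pulse" data on an outgoing null cone `C_{u₀}`, trivial for advanced time
  `u̲ ≤ 0`; the prelude has no characteristic data. We vendor the *existence* consequence: there is
  a vacuum spacetime `𝓢` and a point `p` such that `𝓢` is flat on the causal past `J⁻(p)` and
  contains a closed trapped surface (`LorentzianMetric.IsTrappedSurface`, gr.S18) homeomorphic to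
  `S²` lying in the causal future `J⁺(p)`. In Christodoulou's development the level sets `C_u` are,
  in the Minkowskian region `M₀ = {u̲ < 0}`, future null geodesic cones with vertices `q_u` on the
  central timelike geodesic `Γ₀` (arXiv:0805.3880, pp. 15, 23: `C_q` is the boundary of the causal
  future of `q ∈ Γ₀`), and the trapped spheres of Thm. 17.1 are sections
  `S_{u̲,−1−δ} = C̲_{u̲} ∩ C_{−1−δ}`; so `p := q_{−1−δ} ∈ M₀` has `S_{u̲,−1−δ} ⊆ J⁺(p)` and
  `J⁻(p) ⊆ {u̲ ≤ −1−δ} ⊆ M₀` flat. The vendored `Prop` is strictly weaker than Thm. 17.1 (no data,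
  no quantitative area bound), which is allowed for a named fact; it is not content-free (a vacuum
  spacetime with a flat past region to whose future a closed trapped sphere forms).
* **gr.S24.** Waves live on the open exterior chart `Kerr.exterior M a` (type
  `↥(Kerr.exterior M a)`, model `𝓘(ℝ, E4)`), are `C^∞`, solve `□_g ψ = 0` for the `C^∞` Kerr metric
  (`PseudoRiemannianMetric.dalembertian`, under the instance hypotheses `[Kerr.Facts]`,
  `[Kerr.SliceFacts]` supplying the metric and its Levi-Civita connection), and have data
  compactly supported in the open slice `{t* = 0} ∩ {r > r₊}` (`IsAdmissibleKerrWave`; this is the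
  class to which DRSR reduce in §4.1). The Kerr–Schild leaves `{t* = τ}` are uniformly spacelike up
  to and through `𝓗⁺` (`g^{00} = −1 − 2H`) and asymptotically flat, so on `{r > r₊}` the coordinate
  energy `sliceEnergy` of `WeightedNorms.lean` (`∫ ∑_μ (∂_μ ψ)² dy` over `{t* = τ} ∩ {r > r₊}`) is
  comparable, with constants depending only on `M, a`, to DRSR's non-degenerate `J^N`-energy flux
  through `Σ_τ = {t* = τ}`. The exterior future `{t* ≥ 0, r > r₊}` lies in the future Cauchy
  development of the slice `{t* = 0, r > r₊}` (the chart is ingoing: past-directed causal curves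
  in the exterior neither reach `𝓗⁺` nor leave through `r ↓ r₊` at finite `t*`), so `ψ` is
  determined there by its data, which extend by zero across `𝓗⁺ ∩ {t* = 0}`.
  **Caveat (foliations).** DRSR's hypersurfaces `Σ_τ = {t*_DRSR = τ}` are *not* the Kerr–Schild
  leaves: their Kerr-star time is `t*_DRSR = t + t̄(r)` with `t̄ = r* − r + const` only for
  `r ≤ 15M/8` and `t̄ = 0` for `r ≥ 9M/4` (arXiv:1402.7034, §2.1.3), whereas the chart's
  `t* = t + (r* − r) + const` globally, so `t* − t*_DRSR ~ 2M log r → ∞` at spatial infinity and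
  the Kerr–Schild leaves are not "admissible hypersurfaces of the first kind" (arXiv:1010.5132,
  Def. 4.1). Boundedness in the vendored Kerr–Schild form is therefore a *corollary* of estimate
  (23) of Thm. 3.1 in its generalised form for admissible hypersurfaces (arXiv:1402.7034, §3.3,
  p. 14) combined with two `J^T` energy identities in the far region (where `T = ∂_{t*}` is
  timelike) and finite speed of propagation — the argument of arXiv:1010.5132, Prop. 4.6.1; this
  reduction is carried out in `Literature.Geometry.Lorentzian.KerrWaveEnergy` (graph energies,
  admissible heights, the printed theorem as the named fact
  `DafermosRodnianskiShlapentokhRothman2016_energyBoundedness`) and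
  `Literature.Geometry.Lorentzian.KerrWaveEnergyProofs`, where the far-region `J^T` identity
  (`kerr_far_TEnergy_comparison_of_farRadius_le`) and far-region finite speed of propagation
  (`kerr_far_finite_speed_of_propagation`) are *proved* in Kerr–Schild coordinates, so that
  `drsr_wave_boundedness_kerr_of_DRSR` derives the vendored statement from that single named
  fact. Decay is Cor. 3.1, whose first (unnumbered)
  display bounds the energy flux through the hyperboloidal leaves `Σ̃_τ = φ_τ(Σ̃₀)` by
  `C E τ⁻²` (`E` a higher-order weighted initial energy, finite for smooth compactly supported
  data); choosing `Σ̃₀` to agree with `Σ₀` on `{r ≤ R₁}` (DRSR p. 51) makes `Σ̃_τ` agree with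
  `{t* = τ}` there, and `{‖y‖ ≤ R} ⊆ {r ≤ R₁}` for `R₁` large, whence the vendored local form
  `E_loc(τ, R) ≤ C' τ⁻²` with `C' = C'(M, a, R, ψ) < ∞`. The pointwise bounds (30)–(31) of Cor. 3.1
  are not vendored.
* **Withdrawn sanity statement.** Earlier versions carried an unproved "sanity" statement
  `kerr_docOfEnd_eq_univ` (the Kerr exterior chart is its own domain of outer communications
  relative to `M_ext = ℝ × {R' < ‖y‖}`; O'Neill 1995, Ch. 2; Dafermos–Rodnianski arXiv:0811.0354,
  §5.1). It is a check of *our* encodings (`docOfEnd`, `stationaryOrbit`, `chronologicalFuture` on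
  the Kerr–Schild chart), not a printed theorem, so it is not vendored as a named fact; it is left
  to a prover item (TODO) rather than entering the trust base.

## Mathlib

Mathlib (at the pin) has no Lorentzian geometry, black holes, Killing horizons, trapped
surfaces or wave equations on manifolds (`rg -il 'black hole|trapped surface|Killing
horizon|dalembertian|Kerr metric' Mathlib/Geometry` is empty). We use Mathlib's `Diffeomorph`,
`ContMDiff`, `mfderiv`, `TopologicalSpace.Opens` (open submanifolds), `Metric.sphere`,
`Homeomorph`, `IsCompact`, `Filter.Tendsto`, `ℝ≥0∞`, `Real.rpow`; everything else is from the
H21 Lorentz prelude.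

## References

* B. Carter, PRL 26 (1971) 331; D. C. Robinson, PRL 34 (1975) 905; S. W. Hawking, CMP 25 (1972)
  152.
* P. T. Chruściel, J. L. Costa, *On uniqueness of stationary vacuum black holes*, Astérisque 321
  (2008) 195–265, arXiv:0806.0016, Def. 1.1, Conj. 1.2, Thm. 1.3 (key `ChruscielCosta2008`).
* S. Alexakis, A. D. Ionescu, S. Klainerman, *Uniqueness of smooth stationary black holes in
  vacuum: small perturbations of the Kerr spaces*, Commun. Math. Phys. 299 (2010) 89–127,
  arXiv:0904.0982, §1.1 and Main Theorem (key `AlexakisIonescuKlainerman2009`).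
* D. Christodoulou, *The formation of black holes in general relativity*, EMS Monographs in
  Mathematics (2009), arXiv:0805.3880, Thm. 17.1 (key `Christodoulou2008`); S. Klainerman,
  I. Rodnianski, *On the formation of trapped surfaces*, Acta Math. 208 (2012) 211–333, Thm. 1.
* M. Dafermos, I. Rodnianski, Y. Shlapentokh-Rothman, *Decay for solutions of the wave equation
  on Kerr exterior spacetimes III: the full subextremal case `|a| < M`*, Ann. of Math. 183 (2016)
  787–913, arXiv:1402.7034, Thm. 3.1, Cor. 3.1 (key `DafermosRodnianskiShlapentokhrothman2014`);
  M. Dafermos, I. Rodnianski, *Lectures on black holes and linear waves*, arXiv:0811.0354, §4–§5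
  (key `DafermosRodnianski2008`).
* B. O'Neill, *Semi-Riemannian geometry*, Academic Press 1983, Ch. 3 (key
  `ONeillSemiRiemannian1983`).
-/

noncomputable section

open Bundle Set Manifold TopologicalSpace Filter
open scoped ContDiff Topology ENNReal Manifold

universe u

/-! ### Two elementary facts on the d'Alembertian (dot-notation extension of the H21 structure
`PseudoRiemannianMetric`) -/

namespace Literature.Geometry.Lorentzian.PseudoRiemannianMetric

variable {E : Type*} [NormedAddCommGroup E] [NormedSpace ℝ E] {H : Type*} [TopologicalSpace H]
  {I : ModelWithCorners ℝ E H} {M : Type*} [TopologicalSpace M] [ChartedSpace H M]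
  [IsManifold I ∞ M] {n : ℕ∞ω}

/-- The Hessian of a constant function vanishes (`Hess c (X, Y) = X(Y c) − (∇_X Y) c = 0`), under
the standing Levi-Civita hypothesis `[g.HasLeviCivita]` of the Hessian API. O'Neill 1983, Ch. 3,
Def. 3.48. [cite: ONeillSemiRiemannian1983, Ch. 3 Def. 3.48] -/
theorem hessian_const [FiniteDimensional ℝ E] [CompleteSpace E] [Fact (1 ≤ n)]
    (g : PseudoRiemannianMetric I n E (TangentSpace I : M → Type _)) [g.HasLeviCivita]
    (c : ℝ) (x : M) : g.hessian (fun _ ↦ c) x = 0 := by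
  have haux : ∀ X Y : Π x : M, TangentSpace I x, g.hessianAux (fun _ ↦ c) X Y x = 0 := by
    intro X Y
    simp [PseudoRiemannianMetric.hessianAux, mvfderiv_const]
  unfold PseudoRiemannianMetric.hessian
  have hex : ∃ B : LinearMap.BilinForm ℝ (TangentSpace I x), ∀ X₀ Y₀ : TangentSpace I x,
      B X₀ Y₀ =
        g.hessianAux (fun _ ↦ c) (FiberBundle.extend E X₀) (FiberBundle.extend E Y₀) x :=
    ⟨0, fun _ _ ↦ by simp [haux]⟩
  rw [dif_pos hex]
  ext X₀ Y₀
  simpa [haux] using hex.choose_spec X₀ Y₀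

/-- Constants solve the wave equation: `□_g c = tr_g Hess c = 0` (`[g.HasLeviCivita]` as above).
O'Neill 1983, Ch. 3, Def. 3.50. [cite: ONeillSemiRiemannian1983, Ch. 3 Def. 3.50] -/
theorem dalembertian_const [FiniteDimensional ℝ E] [CompleteSpace E] [Fact (1 ≤ n)]
    (g : PseudoRiemannianMetric I n E (TangentSpace I : M → Type _)) [g.HasLeviCivita]
    (c : ℝ) (x : M) : g.dalembertian (fun _ ↦ c) x = 0 := by
  simp [PseudoRiemannianMetric.dalembertian, g.hessian_const, PseudoRiemannianMetric.trace]

end Literature.Geometry.Lorentzian.PseudoRiemannianMetric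

/-! ### The conclusion of the uniqueness theorems (extension of the hypothesis structure
`StationaryAFBlackHole`) -/

namespace Literature.Geometry.Lorentzian.StationaryAFBlackHole

variable (𝓑 : StationaryAFBlackHole.{u})

/-- **The domain of outer communications of `𝓑` is isometric to a subextremal Kerr exterior**:
there are Kerr parameters `(M, a)` with `|a| < M` and a `C^∞` diffeomorphism `Φ` from the open
submanifold `⟨⟨M_ext⟩⟩ = 𝓑.docOpens hF hP` onto the ingoing Kerr–Schild exterior chart
`Kerr.exterior M a = {r > r₊}` pulling the `C^∞` Kerr metric `Kerr.smoothMetric M a r₊` back to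
the restriction of `𝓑.metric` (an isometry, `PseudoRiemannianMetric.IsIsometry`). This is the
common conclusion of the black-hole uniqueness theorems (Chruściel–Costa, arXiv:0806.0016,
Thm. 1.3: "`⟨⟨M_ext⟩⟩` is isometric to the domain of outer communications of a Kerr space-time";
Alexakis–Ionescu–Klainerman, arXiv:0904.0982, Main Theorem). Openness of the d.o.c. and
smoothness of the restricted metric are the named facts `hF`, `hP`, `hres` of the prelude; the
Kerr metric needs `[Kerr.Facts]`. (Deliberate dot-notation extension of the H21 structure
`StationaryAFBlackHole`.) [folklore] -/
def IsIsometricToKerrExterior [Kerr.Facts]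
    (hF : 𝓑.metric.isOpen_chronologicalFuture 𝓑.timeOrientation)
    (hP : 𝓑.metric.isOpen_chronologicalPast 𝓑.timeOrientation)
    (hres : PseudoRiemannianMetric.contMDiff_restrict (I := 𝓡 4) (n := ∞) (M := 𝓑.carrier)) :
    Prop :=
  ∃ (M a : ℝ) (_ : Kerr.IsSubextremal M a)
    (Φ : Diffeomorph (𝓡 4) 𝓘(ℝ, E4) (𝓑.docOpens hF hP) (Kerr.exterior M a) ∞),
    PseudoRiemannianMetric.IsIsometry
      (𝓑.metric.restrict hres (𝓑.docOpens hF hP)).toPseudoRiemannianMetric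
      (Kerr.smoothMetric M a (Kerr.rPlus M a)).toPseudoRiemannianMetric Φ

end Literature.Geometry.Lorentzian.StationaryAFBlackHole

namespace Literature.Geometry.Lorentzian


/-! ### gr.S23: uniqueness of stationary black holes (statement schemas) -/

/-- **gr.S23** (black-hole uniqueness / "no hair"; Carter, PRL 26 (1971); Robinson, PRL 34
(1975); Hawking, CMP 25 (1972); Chruściel–Costa, arXiv:0806.0016 = Astérisque 321 (2008),
Thm. 1.3), as a **statement schema** in the `I⁺`-regularity hypothesis. For a predicate
`IsIPlusRegular` on stationary asymptotically flat black holes, `stationary_black_hole_uniqueness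
IsIPlusRegular` says: every stationary AF black hole `𝓑` (hypothesis structure
`StationaryAFBlackHole`: complete stationary Killing field timelike on `M_ext`, AF end) which is
`IsIPlusRegular`, **analytic** (`IsAnalytic`), **vacuum** (`Ric(g) = 0`), and whose future event
horizon `𝓔⁺` is **connected** and **non-degenerate** (`IsNonDegenerateHorizon`: a horizon Killing
field tangent to `𝓔⁺` with `∇_K K = κ K`, `κ ≠ 0`, existentially quantified — for rotating holes
it is an output of Hawking's rigidity step; the prelude's rendering of non-degeneracy) has domain of
outer communications isometric to a subextremal Kerr exterior (`IsIsometricToKerrExterior`).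
Chruściel–Costa's Theorem 1.3 as printed — "Let `(M, g)` be a stationary, asymptotically flat,
`I⁺`-regular, vacuum, four-dimensional analytic space-time. If `𝓔⁺` is connected and mean
non-degenerate, then `⟨⟨M_ext⟩⟩` is isometric to the domain of outer communications of a Kerr
space-time" — is this schema **at the transcription of their Def. 1.1** (`⟨⟨M_ext⟩⟩` globally
hyperbolic, containing a spacelike connected acausal hypersurface `S ⊇ Σ_ext` whose closure is a
topological manifold with boundary, compact modulo finitely many ends, with `∂S̄ ⊆ 𝓔⁺` meeting
every generator of `𝓔⁺` precisely once). That predicate is not expressible in the v0 prelude (no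
generators of the achronal boundary `𝓔⁺`), so the theorem is documented here and **not**
asserted; in particular no instance of this schema at a weaker predicate is claimed (the instance
at `fun _ ↦ True` is essentially Chruściel–Costa's open Conjecture 1.2). Instance hypotheses and
the parameters `hF hP hres` are the prelude's standing named facts (Levi-Civita connection,
Kerr chart facts, openness of `I^±`, smoothness of restrictions). [folklore] -/
def stationary_black_hole_uniqueness (IsIPlusRegular : StationaryAFBlackHole.{u} → Prop) :
    Prop :=
  ∀ (𝓑 : StationaryAFBlackHole.{u}) [𝓑.metric.HasLeviCivita] [Kerr.Facts]
    (hF : 𝓑.metric.isOpen_chronologicalFuture 𝓑.timeOrientation)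
    (hP : 𝓑.metric.isOpen_chronologicalPast 𝓑.timeOrientation)
    (hres : PseudoRiemannianMetric.contMDiff_restrict (I := 𝓡 4) (n := ∞) (M := 𝓑.carrier)),
    IsIPlusRegular 𝓑 → 𝓑.IsAnalytic → 𝓑.metric.toPseudoRiemannianMetric.IsRicciFlat →
    IsConnected 𝓑.horizon → 𝓑.toSpacetime.IsNonDegenerateHorizon 𝓑.Mext →
    𝓑.IsIsometricToKerrExterior hF hP hres

/-- Hypothesis form of the gr.S23 schema: if `stationary_black_hole_uniqueness IsIPlusRegular`
holds (Chruściel–Costa 2008, Thm. 1.3, prove this for `I⁺`-regularity in the sense of their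
Def. 1.1), then an `IsIPlusRegular`, analytic, vacuum stationary AF black hole with connected
non-degenerate horizon has d.o.c. isometric to a subextremal Kerr exterior. Tautological
unfolding. [folklore] -/
theorem stationary_black_hole_uniqueness.apply {IsIPlusRegular : StationaryAFBlackHole.{u} → Prop}
    (h : stationary_black_hole_uniqueness IsIPlusRegular) (𝓑 : StationaryAFBlackHole.{u})
    [𝓑.metric.HasLeviCivita] [Kerr.Facts]
    (hF : 𝓑.metric.isOpen_chronologicalFuture 𝓑.timeOrientation)
    (hP : 𝓑.metric.isOpen_chronologicalPast 𝓑.timeOrientation)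
    (hres : PseudoRiemannianMetric.contMDiff_restrict (I := 𝓡 4) (n := ∞) (M := 𝓑.carrier))
    (hreg : IsIPlusRegular 𝓑) (hω : 𝓑.IsAnalytic)
    (hvac : 𝓑.metric.toPseudoRiemannianMetric.IsRicciFlat) (hconn : IsConnected 𝓑.horizon)
    (hnd : 𝓑.toSpacetime.IsNonDegenerateHorizon 𝓑.Mext) :
    𝓑.IsIsometricToKerrExterior hF hP hres :=
  h 𝓑 hF hP hres hreg hω hvac hconn hnd

/-- The **Alexakis–Ionescu–Klainerman rigidity statement schema** (arXiv:0904.0982 = Commun.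
Math. Phys. 299 (2010), §1.1 and Main Theorem: "Under the assumptions **GR**, **SBS** and **PK**
the domain of outer communication `𝓔` of `M` is isometric to the domain of outer communication of
the Kerr space-time with mass `M` and angular momentum `J`"), for a predicate
`IsRegularCloseToKerr` on stationary AF black holes standing for the conjunction of AIK's
hypotheses: **GR** (global regularity — an asymptotic end `ℝ × E_{R₀}` on which `T = ∂₀` with
Kerr-like fall-off, `𝓔 = I⁻(M^{end}) ∩ I⁺(M^{end})` globally hyperbolic, `T` nowhere zero on `𝓔`
with complete orbits meeting the partial Cauchy surface `Σ⁰`), **SBS** (the achronal boundaries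
`δI^∓(M^{end})` are, near their intersection `S₀` — an embedded `2`-sphere, the bifurcation
sphere — smooth, null, non-expanding hypersurfaces meeting transversally, with `T` tangent to
both) and **PK** (perturbation of Kerr: `|(1 − σ) 𝓢(T, T_α, T_β, T_γ)| ≤ ε̄` on `Σ⁰ ∩ 𝓔̄`, `σ` the
Ernst potential and `𝓢` the Mars–Simon tensor of `(g, T)`). None of GR/SBS/PK is a v0 prelude
notion (no bifurcate horizons, Ernst potential or Mars–Simon tensor), whence the predicate
parameter; the schema says "every vacuum stationary AF black hole satisfying
`IsRegularCloseToKerr` — **no analyticity assumed** — has d.o.c. isometric to a subextremal Kerr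
exterior". AIK's Main Theorem is the instance at `GR ∧ SBS ∧ PK`, documented, not asserted (the
instance at `fun _ ↦ True` is the open non-analytic uniqueness problem). Companion of **gr.S23**. [folklore] -/
def AlexakisIonescuKlainermanRigidity (IsRegularCloseToKerr : StationaryAFBlackHole.{u} → Prop) :
    Prop :=
  ∀ (𝓑 : StationaryAFBlackHole.{u}) [𝓑.metric.HasLeviCivita] [Kerr.Facts]
    (hF : 𝓑.metric.isOpen_chronologicalFuture 𝓑.timeOrientation)
    (hP : 𝓑.metric.isOpen_chronologicalPast 𝓑.timeOrientation)
    (hres : PseudoRiemannianMetric.contMDiff_restrict (I := 𝓡 4) (n := ∞) (M := 𝓑.carrier)),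
    IsRegularCloseToKerr 𝓑 → 𝓑.metric.toPseudoRiemannianMetric.IsRicciFlat →
    𝓑.IsIsometricToKerrExterior hF hP hres

/-- **Alexakis–Ionescu–Klainerman rigidity, hypothesis form** (arXiv:0904.0982, Main Theorem;
companion of **gr.S23** with analyticity replaced by closeness to Kerr). Given a predicate
`IsRegularCloseToKerr` for which the AIK schema holds (AIK prove this for GR ∧ SBS ∧ PK), a smooth
— not necessarily analytic — vacuum stationary AF black hole satisfying it has domain of outer
communications isometric to a subextremal Kerr exterior. Tautological unfolding. [folklore] -/
theorem AlexakisIonescuKlainermanRigidity.apply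
    {IsRegularCloseToKerr : StationaryAFBlackHole.{u} → Prop}
    (hAIK : AlexakisIonescuKlainermanRigidity IsRegularCloseToKerr) (𝓑 : StationaryAFBlackHole.{u})
    [𝓑.metric.HasLeviCivita] [Kerr.Facts]
    (hF : 𝓑.metric.isOpen_chronologicalFuture 𝓑.timeOrientation)
    (hP : 𝓑.metric.isOpen_chronologicalPast 𝓑.timeOrientation)
    (hres : PseudoRiemannianMetric.contMDiff_restrict (I := 𝓡 4) (n := ∞) (M := 𝓑.carrier))
    (hclose : IsRegularCloseToKerr 𝓑) (hvac : 𝓑.metric.toPseudoRiemannianMetric.IsRicciFlat) :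
    𝓑.IsIsometricToKerrExterior hF hP hres :=
  hAIK 𝓑 hF hP hres hclose hvac

/-- The gr.S23 schema is the AIK schema at the predicate "`I⁺`-regular, analytic, connected
non-degenerate horizon": both have the same shape, differing only in the hypothesis predicate
(Chruściel–Costa 2008, Thm. 1.3 vs. Alexakis–Ionescu–Klainerman 2010, Main Theorem). The
non-degeneracy clause needs the Levi-Civita connection, whence the inner quantification over the
(proof-irrelevant) instance. [folklore] -/
theorem stationary_black_hole_uniqueness_iff (IsIPlusRegular : StationaryAFBlackHole.{u} → Prop) :
    stationary_black_hole_uniqueness IsIPlusRegular ↔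
      AlexakisIonescuKlainermanRigidity.{u} fun 𝓑 ↦ IsIPlusRegular 𝓑 ∧ 𝓑.IsAnalytic ∧
        IsConnected 𝓑.horizon ∧
          ∀ [𝓑.metric.HasLeviCivita], 𝓑.toSpacetime.IsNonDegenerateHorizon 𝓑.Mext := by
  constructor
  · intro h 𝓑 _ _ hF hP hres hyp hvac
    exact h 𝓑 hF hP hres hyp.1 hyp.2.1 hvac hyp.2.2.1 hyp.2.2.2
  · intro h 𝓑 _ _ hF hP hres hreg hω hvac hconn hnd
    exact h 𝓑 hF hP hres ⟨hreg, hω, hconn, fun {_} ↦ hnd⟩ hvac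

/-! ### gr.S19: dynamical formation of trapped surfaces -/

/-- **gr.S19** (formation of trapped surfaces; Christodoulou, *The formation of black holes in
general relativity*, EMS 2009 = arXiv:0805.3880, Thm. 17.1; Klainerman–Rodnianski, Acta Math. 208
(2012), Thm. 1), **existence-consequence form**. Christodoulou's theorem: for characteristic
vacuum data on an outgoing null cone `C_{u₀}` which are trivial for advanced time `u̲ ≤ 0` and
carry a suitably large "short pulse" on `0 ≤ u̲ ≤ δ` (`δ^{1/2} F(M₈) < k − 1`,
`|u₀|² ∫₀^δ e du̲ ≥ k > 1` in every direction; no symmetry, no smallness), there is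
`u̲* ∈ (0, δ)` such that for all `u̲ ∈ (u̲*, δ)` the spheres `S_{u̲, −1−δ} ⊂ C_{−1−δ}` of the
vacuum development are **trapped spheres**, of area `4π + O(δ)`. The development is Minkowskian
on `M₀ = {u̲ < 0}` and its outgoing null hypersurfaces `C_u` are there the future null geodesic
cones of the points `q_u` of the central timelike geodesic `Γ₀` (loc. cit., pp. 15, 23), so the
trapped sphere `S_{u̲, −1−δ}` lies in `J⁺(q_{−1−δ})` while `J⁻(q_{−1−δ}) ⊆ M₀` is flat. The prelude
has no characteristic initial value problem, so we vendor the (strictly weaker) existence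
statement this implies: there is a four-dimensional vacuum spacetime `𝓢` and a point `p` such
that the Riemann tensor vanishes on the causal past `J⁻(p)` and `𝓢` contains a closed trapped
surface (gr.S18, `IsTrappedSurface`: compact, embedded, spacelike, both null expansions negative
for every null normal pair) homeomorphic to the `2`-sphere and contained in the causal future
`J⁺(p)`. The curvature notions bind the standing Levi-Civita hypothesis `[𝓢.metric.HasLeviCivita]`
(a `Fact`, supplied by `HasLeviCivita.of` from the named fact
`isCovariantDerivativeOn_leviCivitaFun`). [cite: Christodoulou2008, Thm. 17.1] -/
def christodoulou_trapped_surface_formation : Prop :=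
  ∃ 𝓢 : Spacetime.{0} 4, ∀ [𝓢.metric.HasLeviCivita],
    𝓢.metric.toPseudoRiemannianMetric.IsRicciFlat ∧
      ∃ p : 𝓢.carrier,
        (∀ x ∈ 𝓢.metric.causalPast 𝓢.timeOrientation {p},
          𝓢.metric.toPseudoRiemannianMetric.riemann x = 0) ∧
        ∃ (T : Type) (_ : TopologicalSpace T) (_ : ChartedSpace (EuclideanSpace ℝ (Fin 2)) T)
          (_ : IsManifold (𝓡 2) ∞ T) (_ : T ≃ₜ Metric.sphere (0 : E3) 1) (f : T → 𝓢.carrier),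
          𝓢.metric.IsTrappedSurface (𝓡 2) 𝓢.timeOrientation f ∧
            Set.range f ⊆ 𝓢.metric.causalFuture 𝓢.timeOrientation {p}

/-! ### gr.S24: linear waves on subextremal Kerr (Dafermos–Rodnianski–Shlapentokh-Rothman) -/

/-- **Admissible scalar waves on the Kerr exterior.** `ψ : Kerr.exterior M a → ℝ` is a smooth
solution of the wave equation `□_g ψ = 0` for the Kerr metric `g_{M,a}` (d'Alembertian
`PseudoRiemannianMetric.dalembertian` of the `C^∞` Kerr metric `Kerr.smoothMetric M a r₊`, whose
Levi-Civita connection is the instance `Kerr.hasLeviCivita_smoothMetric` under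
`[Kerr.Facts] [Kerr.SliceFacts]`) whose Cauchy data on the Kerr–Schild slice `{t* = 0} ∩ {r > r₊}`
are compactly supported in the open slice: there is a compact `K` such that `ψ` and its full
differential `dψ` vanish at every point of the slice outside `K` (so the data are supported away
from the horizon and from infinity, and all weighted higher-order energies of DRSR are finite).
This is the class of solutions to which Dafermos–Rodnianski–Shlapentokh-Rothman reduce
(arXiv:1402.7034, §4.1: "a reduction to considering `ψ` arising from smooth compactly supported
data on `Σ₀`"); Dafermos–Rodnianski, arXiv:0811.0354, §5.1–5.2. [cite: DafermosRodnianski2008, §5.1–5.2] -/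
def IsAdmissibleKerrWave [Kerr.Facts] [Kerr.SliceFacts] (M a : ℝ) (ψ : Kerr.exterior M a → ℝ) :
    Prop :=
  ContMDiff 𝓘(ℝ, E4) 𝓘(ℝ, ℝ) ∞ ψ ∧
    (∀ x, (Kerr.smoothMetric M a (Kerr.rPlus M a)).toPseudoRiemannianMetric.dalembertian ψ x
      = 0) ∧
    ∃ K : Set (Kerr.exterior M a), IsCompact K ∧
      ∀ x : Kerr.exterior M a, (x : E4) 0 = 0 → x ∉ K →
        ψ x = 0 ∧ mfderiv 𝓘(ℝ, E4) 𝓘(ℝ, ℝ) ψ x = 0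

/-- An admissible Kerr wave is smooth (first clause of the definition; DRSR, arXiv:1402.7034,
§4.1). [folklore] -/
lemma IsAdmissibleKerrWave.contMDiff [Kerr.Facts] [Kerr.SliceFacts] {M a : ℝ}
    {ψ : Kerr.exterior M a → ℝ} (h : IsAdmissibleKerrWave M a ψ) :
    ContMDiff 𝓘(ℝ, E4) 𝓘(ℝ, ℝ) ∞ ψ :=
  h.1

/-- An admissible Kerr wave solves `□_g ψ = 0` (second clause of the definition; DRSR,
arXiv:1402.7034, §4.1). [folklore] -/
lemma IsAdmissibleKerrWave.dalembertian_eq_zero [Kerr.Facts] [Kerr.SliceFacts] {M a : ℝ}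
    {ψ : Kerr.exterior M a → ℝ} (h : IsAdmissibleKerrWave M a ψ) (x : Kerr.exterior M a) :
    (Kerr.smoothMetric M a (Kerr.rPlus M a)).toPseudoRiemannianMetric.dalembertian ψ x = 0 :=
  h.2.1 x

/-- The zero function is an admissible Kerr wave (the class is non-empty; constants solve the wave
equation, `dalembertian_const`). DRSR, arXiv:1402.7034, §4.1. [folklore] -/
lemma isAdmissibleKerrWave_zero [Kerr.Facts] [Kerr.SliceFacts] (M a : ℝ) :
    IsAdmissibleKerrWave M a (fun _ ↦ 0) :=
  ⟨contMDiff_const, fun x ↦ PseudoRiemannianMetric.dalembertian_const _ 0 x,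
    ⟨∅, isCompact_empty, fun _ _ _ ↦ ⟨rfl, mfderiv_const⟩⟩⟩

/-- **gr.S24** (uniform energy boundedness on subextremal Kerr; Dafermos–Rodnianski–
Shlapentokh-Rothman, arXiv:1402.7034 = Ann. of Math. 183 (2016), Thm. 3.1, estimate (23)). As
printed: for `0 ≤ a₀ < M` there is `C = C(a₀, M)` such that for all `|a| ≤ a₀` and all
sufficiently regular solutions `ψ` of `□_{g_{a,M}} ψ = 0` on `𝓡₀ = D⁺(Σ₀)`,
`∫_{Σ_τ} J^N_μ[ψ] n^μ_{Σ_τ} ≤ C ∫_{Σ₀} J^N_μ[ψ] n^μ_{Σ₀}` for all `τ ≥ 0` (23), `Σ_τ = φ_τ(Σ₀)`.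
Vendored form: for `|a| < M` there is a constant `C = C(M, a) < ∞` such that for every admissible
wave `ψ` (`IsAdmissibleKerrWave`: smooth, `□_g ψ = 0` on `{r > r₊}`, data compactly supported in
the open slice `{t* = 0, r > r₊}`) and every `τ ≥ 0`, the coordinate energy `sliceEnergy`
(`∫ ∑_μ (∂_μ ψ)² dy`) through the Kerr–Schild leaf `{t* = τ} ∩ {r > r₊}` is at most `C` times
that through `{t* = 0} ∩ {r > r₊}`. **This is a corollary of (23), not (23) itself**: DRSR's
`Σ_τ = {t*_DRSR = τ}` are level sets of their Kerr-star time `t*_DRSR = t + t̄(r)`, `t̄ = 0` for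
`r ≥ 9M/4` (arXiv:1402.7034, §2.1.3), which agree with the Kerr–Schild leaves near `𝓗⁺` but
differ from them by the logarithmically divergent shift `r* − r ~ 2M log r` at spatial infinity,
so that the Kerr–Schild leaves are not admissible hypersurfaces in the sense of arXiv:1010.5132,
Def. 4.1. The vendored form follows from (23) in its generalised form for admissible
hypersurfaces (arXiv:1402.7034, §3.3, p. 14; arXiv:1010.5132, Prop. 4.6.1) applied to a
Kerr–Schild graph `{t* = F(y)}` which is a leaf near the hole and a DRSR slice far out, two `J^T`
energy identities in the far region where `T = ∂_{t*}` is timelike, and finite speed of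
propagation (coordinate light speed `≤ 1` in the ingoing chart); the leaves and graphs are
uniformly spacelike and horizon-regular, so coordinate energies are comparable to `J^N`-fluxes with
constants depending only on `(M, a)`, and `{t* ≥ 0, r > r₊} ⊆ D⁺({t* = 0, r > r₊})`. This
reduction is proved in `Literature.Geometry.Lorentzian.KerrWaveEnergyProofs`:
`drsr_wave_boundedness_kerr_of_DRSR : DafermosRodnianskiShlapentokhRothman2016_energyBoundedness →
drsr_wave_boundedness_kerr`, the hypothesis being the printed (23) in its §3.3 form for
Kerr–Schild graphs (named fact of `Literature.Geometry.Lorentzian.KerrWaveEnergy`); the far-region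
energy identity and finite speed of propagation are proved there, so the present fact rests on
the printed theorem alone. Instance hypotheses
`[Kerr.Facts] [Kerr.SliceFacts]` supply the Kerr metric and its Levi-Civita connection.
[cite: DafermosRodnianskiShlapentokhrothman2014, Thm. 3.1 (23) with §3.3 (corollary)] -/
def drsr_wave_boundedness_kerr : Prop :=
  ∀ [Kerr.Facts] [Kerr.SliceFacts] (M a : ℝ), Kerr.IsSubextremal M a →
    ∃ C : ℝ≥0∞, C < ⊤ ∧ ∀ ψ : Kerr.exterior M a → ℝ, IsAdmissibleKerrWave M a ψ →
      ∀ τ : ℝ, 0 ≤ τ →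
        sliceEnergy (Kerr.exterior M a) ψ τ ≤ C * sliceEnergy (Kerr.exterior M a) ψ 0

/-- **gr.S24** (polynomial decay of the local energy on subextremal Kerr; Dafermos–Rodnianski–
Shlapentokh-Rothman, arXiv:1402.7034 = Ann. of Math. 183 (2016), Cor. 3.1, first (unnumbered)
energy-flux estimate). As printed: for `a₀, M, a, δ` as in Thms. 3.1–3.2, `R > r₊`, and `Σ̃₀` an
asymptotically hyperboloidal hypersurface terminating at null infinity, `Σ̃_τ = φ_τ(Σ̃₀)`,
sufficiently regular solutions satisfy `∫_{Σ̃_τ} J^N_μ[ψ] n^μ_{Σ̃_τ} ≤ C E τ⁻²`, where `E` denotes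
an appropriate higher-order weighted energy on `Σ̃₀` (or on an asymptotically flat `Σ₀` in the
past of `Σ̃₀`). Vendored local-energy consequence, with the printed rate: for `|a| < M`, every
admissible wave `ψ` and every coordinate radius `R` admit a finite constant `C' = C'(M, a, R, ψ)`
with `E_loc(τ, R) := localSliceEnergy ψ τ R ≤ C' τ⁻²` for all `τ ≥ 1` (local coordinate energy
through `{t* = τ} ∩ {r > r₊} ∩ {‖y‖ ≤ R}`). Derivation: choose `Σ̃₀` agreeing with `{t* = 0}` on
`{r ≤ R₁}` (DRSR p. 51), so that `Σ̃_τ` agrees with `{t* = τ}` on `{r ≤ R₁} ⊇ {‖y‖ ≤ R}`; there the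
coordinate energy density is bounded by `C(M, a, R₁)` times the `J^N`-flux density; and `E < ∞`
for smooth compactly supported data. The companion bound `∫_{Σ̃_τ ∩ {r ≤ R}} J^N[Nψ] n ≤ C E τ^{−4+2δ}`
and the pointwise estimates (30)–(31) are not vendored. [cite: DafermosRodnianskiShlapentokhrothman2014, Cor. 3.1] -/
def drsr_wave_polynomial_decay_kerr : Prop :=
  ∀ [Kerr.Facts] [Kerr.SliceFacts] (M a : ℝ), Kerr.IsSubextremal M a →
    ∀ ψ : Kerr.exterior M a → ℝ, IsAdmissibleKerrWave M a ψ → ∀ R : ℝ,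
      ∃ C' : ℝ≥0∞, C' < ⊤ ∧ ∀ τ : ℝ, 1 ≤ τ →
        localSliceEnergy (Kerr.exterior M a) ψ τ R ≤ C' * ENNReal.ofReal (τ ^ (-2 : ℝ))

/-- **gr.S24** (local energy decay on subextremal Kerr; Dafermos–Rodnianski–Shlapentokh-Rothman,
arXiv:1402.7034 = Ann. of Math. 183 (2016), Cor. 3.1, qualitative consequence of the energy-flux
estimate `∫_{Σ̃_τ} J^N n ≤ C E τ⁻²`). For `|a| < M`, every admissible wave (smooth solution of
`□_g ψ = 0` on the Kerr exterior with data compactly supported in the open slice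
`{t* = 0, r > r₊}`) has local energy through `{t* = τ} ∩ {r > r₊} ∩ {‖y‖ ≤ R}` tending to `0` as
`τ → ∞`, for every coordinate radius `R` (the energy leaves every bounded region, through `𝓗⁺`
and `𝓘⁺`). This is *derived* from `drsr_wave_polynomial_decay_kerr`
(`drsr_wave_local_energy_decay_kerr_of_polynomial_decay`). [cite: DafermosRodnianskiShlapentokhrothman2014, Cor. 3.1] -/
def drsr_wave_local_energy_decay_kerr : Prop :=
  ∀ [Kerr.Facts] [Kerr.SliceFacts] (M a : ℝ), Kerr.IsSubextremal M a →
    ∀ ψ : Kerr.exterior M a → ℝ, IsAdmissibleKerrWave M a ψ → ∀ R : ℝ,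
      Tendsto (fun τ : ℝ ↦ localSliceEnergy (Kerr.exterior M a) ψ τ R) atTop (𝓝 0)

/-- Polynomial decay `E_loc(τ, R) ≤ C' τ⁻²` (`τ ≥ 1`, `C' < ∞`) implies `E_loc(τ, R) → 0`:
the qualitative local-energy-decay statement follows from the quantitative one (squeeze between
`0` and `C' τ⁻² → 0` in `ℝ≥0∞`). DRSR, arXiv:1402.7034, Cor. 3.1. [folklore] -/
theorem drsr_wave_local_energy_decay_kerr_of_polynomial_decay
    (h : drsr_wave_polynomial_decay_kerr) : drsr_wave_local_energy_decay_kerr := by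
  intro _ _ M a hMa ψ hψ R
  obtain ⟨C', hC', hb⟩ := h M a hMa ψ hψ R
  have h1 : Tendsto (fun τ : ℝ ↦ ENNReal.ofReal (τ ^ (-2 : ℝ))) atTop (𝓝 0) := by
    simpa using ENNReal.tendsto_ofReal (tendsto_rpow_neg_atTop (by norm_num : (0 : ℝ) < 2))
  have hmaj : Tendsto (fun τ : ℝ ↦ C' * ENNReal.ofReal (τ ^ (-2 : ℝ))) atTop (𝓝 0) := by
    simpa using ENNReal.Tendsto.const_mul h1 (Or.inr hC'.ne)
  refine tendsto_of_tendsto_of_tendsto_of_le_of_le' tendsto_const_nhds hmaj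
    (Eventually.of_forall fun _ ↦ zero_le) ?_
  filter_upwards [eventually_ge_atTop (1 : ℝ)] with τ hτ using hb τ hτ

end Literature.Geometry.Lorentzian

end
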